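import Summits.AtomisticToContinuum.HydrodynamicLimit.Theorems.CollisionIsometryCLTAdaptedWeightCLTBlockHDissipation
import Summits.AtomisticToContinuum.HydrodynamicLimit.Theorems.AntiMazurCoboundariesCorrectorPressureDecayHellingerSplit
import Mathlib.InformationTheory.KullbackLeibler.KLFun

/-!
# Stub `stub_eepClosure` (S5) of the line `block-h-dissipation-closure`, helper file 5: an `L¹`–relative-entropy
inequality of Csiszár–Kullback–Pinsker type (elementary form, no square root)
(crux `CollisionIsometryCLT.AdaptedWeightCLT`, stmt-AtomisticToContinuum-14868; `--supports`)

Step (iii), first half, of the planner's sketch of `stub_eepClosure`: the relative entropy `H(f | g) = ∫ f log(f/g)`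
of two probability densities controls their `L¹` distance. We prove the PARAMETRIC form
`∫ |f − g| dμ ≤ H(f | g)/(2τ) + 2τ` for every `τ > 0` (`integral_abs_sub_le_klDiv_param`; optimising in `τ` would
give `‖f − g‖₁ ≤ 2 √H`, a Pinsker inequality with constant `4` instead of `2`; the parametric form is what the
cell-closure bookkeeping consumes, and needs no square roots). It rests on two pointwise facts:
* `(√x − 1)² ≤ x log x + 1 − x` for `x ≥ 0` (landed `KineticEntropyCollisionBudget.sq_sqrt_sub_one_le_klFun`) —
  relative entropy dominates the squared Hellinger distance;
* `|f − g| = |√f − √g| (√f + √g) ≤ (√f − √g)²/(2τ) + τ (f + g)` (AM–GM and `(√f + √g)² ≤ 2f + 2g`).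
No definitions. Registered anchor: `bhEEPClosure_pinsker_anchor` (the integrated inequality, `∀`-closed).
References: standard (e.g. Villani, *Topics in Optimal Transportation*, §9 bibliographical notes on
Csiszár–Kullback–Pinsker; Cover–Thomas Lemma 11.6.1); here fully proved.
-/

namespace Summit.AtomisticToContinuum.HydrodynamicLimit.Theorems.BlockHDissipation

open scoped BigOperators Topology Classical MeasureTheory ENNReal InnerProductSpace
open Filter Set MeasureTheory Real InformationTheory

noncomputable section

namespace EEP

/-! ## Pointwise -/

/-- For `f ≥ 0 < g`: `(√f − √g)² ≤ f log(f/g) + g − f` (`= g · klFun(f/g)`). -/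
theorem sqrt_sub_sqrt_sq_le {f g : ℝ} (hf : 0 ≤ f) (hg : 0 < g) :
    (Real.sqrt f - Real.sqrt g) ^ 2 ≤ f * log (f / g) + g - f := by
  have h1 := KineticEntropyCollisionBudget.sq_sqrt_sub_one_le_klFun (div_nonneg hf hg.le)
  rw [klFun_apply] at h1
  have hsq : (Real.sqrt f - Real.sqrt g) ^ 2 = g * (Real.sqrt (f / g) - 1) ^ 2 := by
    have hsg : 0 < Real.sqrt g := Real.sqrt_pos.2 hg
    have hg2 : Real.sqrt g ^ 2 = g := Real.sq_sqrt hg.le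
    rw [Real.sqrt_div hf]
    have : Real.sqrt f / Real.sqrt g - 1 = (Real.sqrt f - Real.sqrt g) / Real.sqrt g := by
      field_simp
    rw [this, div_pow, hg2, mul_div_cancel₀ _ hg.ne']
  rw [hsq]
  calc g * (Real.sqrt (f / g) - 1) ^ 2 ≤ g * (f / g * log (f / g) + 1 - f / g) :=
        mul_le_mul_of_nonneg_left h1 hg.le
    _ = f * log (f / g) + g - f := by field_simp

/-- **Pointwise Pinsker-type inequality**: for `f ≥ 0 < g` and `τ > 0`,
`|f − g| ≤ (f log(f/g) + g − f)/(2τ) + τ (f + g)`. -/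
theorem abs_sub_le_klTerm {f g τ : ℝ} (hf : 0 ≤ f) (hg : 0 < g) (hτ : 0 < τ) :
    |f - g| ≤ (f * log (f / g) + g - f) / (2 * τ) + τ * (f + g) := by
  set x := Real.sqrt f with hx
  set y := Real.sqrt g with hy
  have hx0 : 0 ≤ x := Real.sqrt_nonneg f
  have hy0 : 0 ≤ y := Real.sqrt_nonneg g
  have hfx : f = x ^ 2 := (Real.sq_sqrt hf).symm
  have hgy : g = y ^ 2 := (Real.sq_sqrt hg.le).symm
  have hH := sqrt_sub_sqrt_sq_le hf hg
  rw [← hx, ← hy] at hH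
  -- `|f − g| = |x − y| (x + y) ≤ (x − y)²/(2τ) + (τ/2)(x + y)²`, `(x + y)² ≤ 2 (x² + y²)`
  have habs : |f - g| = |x - y| * (x + y) := by
    rw [hfx, hgy, sq_sub_sq, abs_mul, abs_of_nonneg (add_nonneg hx0 hy0), mul_comm]
  have hamgm : |x - y| * (x + y) ≤ (x - y) ^ 2 / (2 * τ) + τ / 2 * (x + y) ^ 2 := by
    have h := sq_nonneg (|x - y| - τ * (x + y))
    have h2 : |x - y| ^ 2 = (x - y) ^ 2 := sq_abs _
    rw [div_add' _ _ _ (by positivity : (2 * τ) ≠ 0), le_div_iff₀ (by positivity : (0 : ℝ) < 2 * τ)]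
    nlinarith [h, h2, hτ]
  rw [habs]
  calc |x - y| * (x + y) ≤ (x - y) ^ 2 / (2 * τ) + τ / 2 * (x + y) ^ 2 := hamgm
    _ ≤ (f * log (f / g) + g - f) / (2 * τ) + τ / 2 * (2 * (f + g)) := by
        refine add_le_add (div_le_div_of_nonneg_right hH (by positivity)) (mul_le_mul_of_nonneg_left ?_ (by positivity))
        rw [hfx, hgy]; nlinarith [sq_nonneg (x - y)]
    _ = (f * log (f / g) + g - f) / (2 * τ) + τ * (f + g) := by ring

/-! ## Integrated -/

/-- **`L¹`–relative-entropy inequality (parametric Csiszár–Kullback–Pinsker).** For probability densities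
`f ≥ 0`, `g > 0` with respect to `μ` with `f log(f/g)` integrable, and every `τ > 0`:
`∫ |f − g| dμ ≤ (∫ f log(f/g) dμ)/(2τ) + 2τ`. -/
theorem integral_abs_sub_le_klDiv_param {α : Type*} [MeasurableSpace α] {μ : Measure α} {f g : α → ℝ}
    (hf0 : ∀ x, 0 ≤ f x) (hg0 : ∀ x, 0 < g x) (hfi : Integrable f μ) (hgi : Integrable g μ)
    (hf1 : ∫ x, f x ∂μ = 1) (hg1 : ∫ x, g x ∂μ = 1)
    (hkl : Integrable (fun x => f x * log (f x / g x)) μ) {τ : ℝ} (hτ : 0 < τ) :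
    ∫ x, |f x - g x| ∂μ ≤ (∫ x, f x * log (f x / g x) ∂μ) / (2 * τ) + 2 * τ := by
  have hpt : ∀ x, |f x - g x| ≤ (f x * log (f x / g x) + g x - f x) / (2 * τ) + τ * (f x + g x) :=
    fun x => abs_sub_le_klTerm (hf0 x) (hg0 x) hτ
  have hI1 : Integrable (fun x => (f x * log (f x / g x) + g x - f x) / (2 * τ)) μ :=
    ((hkl.fun_add hgi).sub' hfi).div_const _
  have hI2 : Integrable (fun x => τ * (f x + g x)) μ := (hfi.fun_add hgi).const_mul τ
  calc ∫ x, |f x - g x| ∂μ ≤ ∫ x, ((f x * log (f x / g x) + g x - f x) / (2 * τ) + τ * (f x + g x)) ∂μ :=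
        integral_mono (hfi.sub' hgi).abs (hI1.fun_add hI2) hpt
    _ = ((∫ x, f x * log (f x / g x) ∂μ) + 1 - 1) / (2 * τ) + τ * (1 + 1) := by
        rw [integral_add hI1 hI2, integral_div, integral_sub (hkl.fun_add hgi) hfi, integral_add hkl hgi,
          integral_const_mul, integral_add hfi hgi, hf1, hg1]
    _ = (∫ x, f x * log (f x / g x) ∂μ) / (2 * τ) + 2 * τ := by ring

/-- Gibbs' inequality in the same setting: `0 ≤ ∫ f log(f/g)` (take `τ` large above, or directly from
`f log(f/g) ≥ f − g` pointwise). -/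
theorem integral_mul_log_div_nonneg {α : Type*} [MeasurableSpace α] {μ : Measure α} {f g : α → ℝ}
    (hf0 : ∀ x, 0 ≤ f x) (hg0 : ∀ x, 0 < g x) (hfi : Integrable f μ) (hgi : Integrable g μ)
    (hf1 : ∫ x, f x ∂μ = 1) (hg1 : ∫ x, g x ∂μ = 1)
    (hkl : Integrable (fun x => f x * log (f x / g x)) μ) :
    0 ≤ ∫ x, f x * log (f x / g x) ∂μ := by
  have hpt : ∀ x, f x - g x ≤ f x * log (f x / g x) := fun x => by
    have := sqrt_sub_sqrt_sq_le (hf0 x) (hg0 x)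
    nlinarith [sq_nonneg (Real.sqrt (f x) - Real.sqrt (g x))]
  have h := integral_mono (hfi.sub' hgi) hkl hpt
  rw [integral_sub hfi hgi, hf1, hg1, sub_self] at h
  exact h

end EEP

/-- Registered anchor of this helper file: the parametric Csiszár–Kullback–Pinsker inequality
`∫ |f − g| dμ ≤ (∫ f log(f/g) dμ)/(2τ) + 2τ` (`EEP.integral_abs_sub_le_klDiv_param`). -/
theorem bhEEPClosure_pinsker_anchor : ∀ {α : Type*} [MeasurableSpace α] (μ : MeasureTheory.Measure α) (f g : α → ℝ), (∀ x, 0 ≤ f x) → (∀ x, 0 < g x) → MeasureTheory.Integrable f μ → MeasureTheory.Integrable g μ → ∫ x, f x ∂μ = 1 → ∫ x, g x ∂μ = 1 → MeasureTheory.Integrable (fun x => f x * Real.log (f x / g x)) μ → ∀ τ : ℝ, 0 < τ → ∫ x, |f x - g x| ∂μ ≤ (∫ x, f x * Real.log (f x / g x) ∂μ) / (2 * τ) + 2 * τ :=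
  fun μ _ _ hf0 hg0 hfi hgi hf1 hg1 hkl _ hτ => EEP.integral_abs_sub_le_klDiv_param (μ := μ) hf0 hg0 hfi hgi hf1 hg1 hkl hτ

end

end Summit.AtomisticToContinuum.HydrodynamicLimit.Theorems.BlockHDissipation
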